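import Mathlib.Algebra.Homology.HomologicalComplexAbelian
import Mathlib.Algebra.Homology.Embedding.Extend
import Literature.Algebra.Homology.StaircaseExact
import HarnessLib

/-!
# Presentation of the staircase images of a staircase quotient: `q^{a}(K/q^{b}) = q^{a}K / q^{b}K`

Continuation of `Algebra/Homology/StaircaseComplexes` and `…/StaircaseExact`. For an abelian
category `𝒜`, a complex `K : CochainComplex 𝒜 ℕ`, `q : ℤ` and antitone exponent functions `a ≤ b`
(pointwise) we have the staircase image subcomplexes `q^{b}K ⊆ q^{a}K ⊆ K` (`powImage K q _`,
`powImageLE`) and, inside the staircase quotient `K/q^{b} = powQuotient K q hb`, the staircase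
image `q^{a}(K/q^{b})` — for the de Rham complex `K = Ω•_{𝒳/W}`, `q = p`, `a = (r-•)M`,
`b = (r-•)N` this is X. Hu's complex `p^{r,M}_{r,N}Ω•` (`AlgebraicGeometry/Crystalline/HuComplexes`,
arXiv:2507.12458 Def. 8.2) and `q^{a}K = p^{(r-•)M}Ω•` is the Bloch–Esnault–Kerz-type complex
`[p^{rM}𝒪 → p^{(r-1)M}Ω¹ → ⋯]` (arXiv:1203.2776 §2). This file proves the PRESENTATION

`0 ⟶ q^{b}K ⟶ q^{a}K ⟶ q^{a}(K/q^{b}) ⟶ 0`     (`staircasePresentation_shortExact`)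

— a short exact sequence of complexes for EVERY `K` (no torsion hypothesis: degreewise the kernel
of `q^{a}T → q^{a}(T/q^{b}T)` is `q^{a}T ∩ q^{b}T = q^{b}T`), where the second map
`powImageToQuotient` is the push-forward of staircase images along the projection `K ⟶ K/q^{b}`.
Torsion-freeness of the terms is only needed to IDENTIFY `q^{a}K ≅ K` (`StaircaseRetraction`) and
`q^{a}(T/q^{b}) ≅ T/q^{b-a}` (`StaircaseTorsionFree`). Also here:

* functoriality of the push-forward (`powImageMap_comp`, `powImageMap_id`) and transitivity of the
  inclusions (`powImageLE_comp`, `powImageLE_refl`);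
* NATURALITY of the presentation in `b` (`staircasePresentationMapOfLE`, over the reduction
  `K/q^{b'} → K/q^{b}`, `b ≤ b'`) and in `a` (`staircasePresentationMapOfLE'`, `a' ≤ a`), as
  morphisms of short complexes — the input of `HyperExt.delta_naturality`;
* `shortExact_map_extendFunctor`: the extension by zero of complexes along an embedding of complex
  shapes (Mathlib's `ComplexShape.Embedding.extendFunctor`, e.g. `ℕ ↪ ℤ`,
  `ComplexShape.embeddingUpNat`) takes short exact sequences of complexes to short exact sequences
  (degreewise: the original sequence, or `0 → 0 → 0`), so that the long exact hyper-Ext /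
  hypercohomology sequences (`Algebra/Homology/HyperExt`) apply to the `ℤ`-extensions;
  `staircasePresentation_shortExact_extend` is the case at hand.

[folklore] Everything is proved; no named facts.
-/

noncomputable section

namespace Literature.Algebra.Homology

open CategoryTheory CategoryTheory.Limits

universe v u

variable {𝒜 : Type u} [Category.{v} 𝒜] [Abelian 𝒜]

/-! ### Functoriality of push-forwards and transitivity of inclusions of staircase images -/

section Functoriality

variable (Q : CochainComplex 𝒜 ℕ) (q : ℤ) {e : ℕ → ℕ} (he : Antitone e)

/-- Push-forward of staircase images is functorial: `(q^{e}φ) ≫ (q^{e}ψ) = q^{e}(φ ≫ ψ)`.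
[folklore] -/
@[reassoc]
theorem powImageMap_comp {Q' Q'' : CochainComplex 𝒜 ℕ} (φ : Q ⟶ Q') (ψ : Q' ⟶ Q'') :
    powImageMap Q q he φ ≫ powImageMap Q' q he ψ = powImageMap Q q he (φ ≫ ψ) := by
  refine HomologicalComplex.hom_ext _ _ fun j ↦ ?_
  rw [HomologicalComplex.comp_f, powImageMap_f, powImageMap_f, powImageMap_f,
    ← cancel_mono (image.ι (powSMul Q'' q e j)), Category.assoc, powImageMapf_ι,
    powImageMapf_ι_assoc, powImageMapf_ι, HomologicalComplex.comp_f]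

/-- Push-forward of staircase images along the identity is the identity. [folklore] -/
theorem powImageMap_id : powImageMap Q q he (𝟙 Q) = 𝟙 _ := by
  refine HomologicalComplex.hom_ext _ _ fun j ↦ ?_
  rw [powImageMap_f, HomologicalComplex.id_f, ← cancel_mono (image.ι (powSMul Q q e j)),
    powImageMapf_ι, HomologicalComplex.id_f, Category.comp_id, Category.id_comp]

variable {e' e'' : ℕ → ℕ} (he' : Antitone e') (he'' : Antitone e'')

/-- The inclusions of staircase images are transitive: `(q^{e''} ⊆ q^{e'}) ≫ (q^{e'} ⊆ q^{e}) =
(q^{e''} ⊆ q^{e})` for `e ≤ e' ≤ e''`. [folklore] -/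
@[reassoc]
theorem powImageLE_comp (h : e ≤ e') (h' : e' ≤ e'') :
    powImageLE Q q he' he'' h' ≫ powImageLE Q q he he' h = powImageLE Q q he he'' (h.trans h') := by
  refine HomologicalComplex.hom_ext _ _ fun j ↦ ?_
  rw [HomologicalComplex.comp_f, powImageLE_f, powImageLE_f, powImageLE_f,
    ← cancel_mono (image.ι (powSMul Q q e j)), Category.assoc, powImageLEf_ι, powImageLEf_ι,
    powImageLEf_ι]

/-- The inclusion of staircase images for `e ≤ e` is the identity. [folklore] -/
theorem powImageLE_refl : powImageLE Q q he he le_rfl = 𝟙 _ := by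
  refine HomologicalComplex.hom_ext _ _ fun j ↦ ?_
  rw [powImageLE_f, HomologicalComplex.id_f, ← cancel_mono (image.ι (powSMul Q q e j)),
    powImageLEf_ι, Category.id_comp]

/-- Inclusions and push-forwards of staircase images commute: for `φ : Q ⟶ Q'` and `e ≤ e'`,
`(q^{e'}Q ⊆ q^{e}Q) ≫ q^{e}φ = q^{e'}φ ≫ (q^{e'}Q' ⊆ q^{e}Q')`. [folklore] -/
@[reassoc]
theorem powImageLE_comp_powImageMap_eq {Q' : CochainComplex 𝒜 ℕ} (φ : Q ⟶ Q') (h : e ≤ e') :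
    powImageLE Q q he he' h ≫ powImageMap Q q he φ =
      powImageMap Q q he' φ ≫ powImageLE Q' q he he' h := by
  refine HomologicalComplex.hom_ext _ _ fun j ↦ ?_
  rw [HomologicalComplex.comp_f, HomologicalComplex.comp_f, powImageLE_f, powImageMap_f,
    powImageMap_f, powImageLE_f, ← cancel_mono (image.ι (powSMul Q' q e j)), Category.assoc,
    Category.assoc, powImageMapf_ι, powImageLEf_ι_assoc, powImageLEf_ι, powImageMapf_ι]

end Functoriality

/-! ### The presentation `0 → q^{b}K → q^{a}K → q^{a}(K/q^{b}) → 0` -/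

section Presentation

variable (K : CochainComplex 𝒜 ℕ) (q : ℤ) {a b : ℕ → ℕ} (ha : Antitone a) (hb : Antitone b)

/-- **The projection `q^{a}K ⟶ q^{a}(K/q^{b})`**: push-forward of the staircase images along
`K ⟶ K/q^{b}` (for `K = Ω•`: `p^{(r-•)M}Ω• ⟶ p^{r,M}_{r,N}Ω•`). [folklore] -/
abbrev powImageToQuotient : powImage K q ha ⟶ powImage (powQuotient K q hb) q ha :=
  powImageMap K q ha (powQuotientπ K q hb)

/-- The components of `powImageToQuotient` over the inclusions: `(proj)ʲ ≫ ι = ι ≫ π` with `π` the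
cokernel projection of `q^{b j}`. [folklore] -/
@[reassoc]
theorem powImageToQuotient_f_ι (j : ℕ) :
    (powImageToQuotient K q ha hb).f j ≫ image.ι (powSMul (powQuotient K q hb) q a j) =
      image.ι (powSMul K q a j) ≫ cokernel.π (powSMul K q b j) := by
  rw [powImageMap_f, powImageMapf_ι, powQuotientπ_f]

/-- `powImageToQuotient` is degreewise an epimorphism. [folklore] -/
instance epi_powImageToQuotient_f (j : ℕ) : Epi ((powImageToQuotient K q ha hb).f j) := by
  rw [powImageMap_f]
  haveI : Epi (factorThruImage (powSMul K q a j) ≫ powImageMapf K q (powQuotientπ K q hb) j) := by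
    rw [factorThruImage_comp_powImageMapf, powQuotientπ_f]
    exact epi_comp _ _
  exact epi_of_epi (factorThruImage (powSMul K q a j)) _

/-- `ι_{q^b} ≫ π_{q^b} = 0`: the image of `q^{b j}` dies in the cokernel of `q^{b j}`. [folklore] -/
@[reassoc]
theorem imageι_comp_cokernelπ_powSMul (j : ℕ) :
    image.ι (powSMul K q b j) ≫ cokernel.π (powSMul K q b j) = 0 := by
  rw [← cancel_epi (factorThruImage (powSMul K q b j)), image.fac_assoc, comp_zero,
    cokernel.condition]

/-- The sequence `q^{b j}Kʲ ↪ Kʲ ↠ Kʲ/q^{b j}` is exact. [folklore] -/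
theorem exact_imageι_cokernelπ_powSMul (j : ℕ) :
    (ShortComplex.mk (image.ι (powSMul K q b j)) (cokernel.π (powSMul K q b j))
      (imageι_comp_cokernelπ_powSMul K q j)).Exact := by
  let S₁ : ShortComplex 𝒜 := ShortComplex.mk (powSMul K q b j) (cokernel.π (powSMul K q b j))
    (cokernel.condition _)
  let S₂ : ShortComplex 𝒜 := ShortComplex.mk (image.ι (powSMul K q b j))
    (cokernel.π (powSMul K q b j)) (imageι_comp_cokernelπ_powSMul K q j)
  let φ : S₁ ⟶ S₂ :=
    { τ₁ := factorThruImage (powSMul K q b j)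
      τ₂ := 𝟙 _
      τ₃ := 𝟙 _
      comm₁₂ := by
        change factorThruImage _ ≫ image.ι _ = powSMul K q b j ≫ 𝟙 _
        rw [image.fac, Category.comp_id]
      comm₂₃ := by
        change 𝟙 _ ≫ cokernel.π (powSMul K q b j) = cokernel.π (powSMul K q b j) ≫ 𝟙 _
        rw [Category.id_comp, Category.comp_id] }
  haveI : Epi φ.τ₁ := by change Epi (factorThruImage _); infer_instance
  haveI : IsIso φ.τ₂ := by change IsIso (𝟙 _); infer_instance
  haveI : Mono φ.τ₃ := by change Mono (𝟙 _); infer_instance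
  exact (ShortComplex.exact_iff_of_epi_of_isIso_of_mono φ).mp
    (ShortComplex.exact_of_g_is_cokernel _ (cokernelIsCokernel (powSMul K q b j)))

variable (hab : a ≤ b)

/-- The composite `q^{b}K ⟶ q^{a}K ⟶ q^{a}(K/q^{b})` vanishes. [folklore] -/
theorem powImageLE_comp_powImageToQuotient :
    powImageLE K q ha hb hab ≫ powImageToQuotient K q ha hb = 0 := by
  refine HomologicalComplex.hom_ext _ _ fun j ↦ ?_
  rw [HomologicalComplex.comp_f, HomologicalComplex.zero_f, powImageLE_f]
  exact comp_eq_zero_of_fac (powImageLEf_ι _ q hab j) (powImageToQuotient_f_ι K q ha hb j)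
    (imageι_comp_cokernelπ_powSMul K q j)

/-- **The presentation of `q^{a}(K/q^{b})`**: the three-term sequence
`q^{b}K ⟶ q^{a}K ⟶ q^{a}(K/q^{b})` (`a ≤ b` antitone) as a short complex of cochain complexes; for
`K = Ω•_{𝒳/W}`: `p^{(r-•)N}Ω• ⟶ p^{(r-•)M}Ω• ⟶ p^{r,M}_{r,N}Ω•`. [folklore] -/
def staircasePresentationShortComplex : ShortComplex (CochainComplex 𝒜 ℕ) :=
  ShortComplex.mk _ _ (powImageLE_comp_powImageToQuotient K q ha hb hab)

/-- The objects of the presentation are `q^{b}K`, `q^{a}K`, `q^{a}(K/q^{b})` (definitionally).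
[folklore] -/
theorem staircasePresentationShortComplex_X :
    (staircasePresentationShortComplex K q ha hb hab).X₁ = powImage K q hb ∧
      (staircasePresentationShortComplex K q ha hb hab).X₂ = powImage K q ha ∧
        (staircasePresentationShortComplex K q ha hb hab).X₃ = powImage (powQuotient K q hb) q ha :=
  ⟨rfl, rfl, rfl⟩

/-- The maps of the presentation are the inclusion and the projection (definitionally).
[folklore] -/
theorem staircasePresentationShortComplex_f_g :
    (staircasePresentationShortComplex K q ha hb hab).f = powImageLE K q ha hb hab ∧
      (staircasePresentationShortComplex K q ha hb hab).g = powImageToQuotient K q ha hb :=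
  ⟨rfl, rfl⟩

/-- Degreewise, the presentation is a short exact sequence
`0 → q^{b j}Kʲ → q^{a j}Kʲ → q^{a j}(Kʲ/q^{b j}Kʲ) → 0`. [folklore] -/
theorem staircasePresentation_shortExact_f (j : ℕ) :
    ((staircasePresentationShortComplex K q ha hb hab).map
      (HomologicalComplex.eval 𝒜 (ComplexShape.up ℕ) j)).ShortExact where
  mono_f := by
    change Mono (powImageLEf K q hab j)
    exact mono_of_mono_fac (powImageLEf_ι _ q hab j)
  epi_g := by
    change Epi ((powImageToQuotient K q ha hb).f j)
    infer_instance
  exact := exact_of_fac_of_exact (powImageLEf_ι _ q hab j) (powImageToQuotient_f_ι K q ha hb j)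
    (imageι_comp_cokernelπ_powSMul K q j) (exact_imageι_cokernelπ_powSMul K q j) _

/-- **The presentation `0 → q^{b}K → q^{a}K → q^{a}(K/q^{b}) → 0` is short exact** for every
complex `K` and antitone `a ≤ b` (for `K = Ω•_{𝒳/W}`: Hu's `p^{r,M}_{r,N}Ω•` is the quotient of
`p^{(r-•)M}Ω•` by `p^{(r-•)N}Ω•`, `M ≤ N`). [folklore] -/
theorem staircasePresentation_shortExact :
    (staircasePresentationShortComplex K q ha hb hab).ShortExact :=
  HomologicalComplex.shortExact_of_degreewise_shortExact _
    (staircasePresentation_shortExact_f K q ha hb hab)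

end Presentation

/-! ### Naturality of the presentation -/

section Naturality

variable (K : CochainComplex 𝒜 ℕ) (q : ℤ) {a b b' : ℕ → ℕ} (ha : Antitone a) (hb : Antitone b)
  (hb' : Antitone b') (hab : a ≤ b) (hbb' : b ≤ b')

/-- The projections are compatible with the reductions: `(q^{a}K → q^{a}(K/q^{b'})) ≫
q^{a}(K/q^{b'} → K/q^{b}) = (q^{a}K → q^{a}(K/q^{b}))` for `b ≤ b'`. [folklore] -/
@[reassoc]
theorem powImageToQuotient_comp_powImageMap_powQuotientMap :
    powImageToQuotient K q ha hb' ≫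
        powImageMap (powQuotient K q hb') q ha (powQuotientMap K q hb hb' hbb') =
      powImageToQuotient K q ha hb := by
  rw [powImageMap_comp, powQuotientπ_comp_powQuotientMap]

/-- **Naturality of the presentation in `b`**: for `a ≤ b ≤ b'` the morphism of short complexes
from `q^{b'}K → q^{a}K → q^{a}(K/q^{b'})` to `q^{b}K → q^{a}K → q^{a}(K/q^{b})` given by the
inclusion `q^{b'}K ⊆ q^{b}K`, the identity, and the push-forward along the reduction
`K/q^{b'} → K/q^{b}` (for `K = Ω•`: over Hu's reduction `p^{r,M}_{r,N'}Ω• → p^{r,M}_{r,N}Ω•`).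
[folklore] -/
def staircasePresentationMapOfLE :
    staircasePresentationShortComplex K q ha hb' (hab.trans hbb') ⟶
      staircasePresentationShortComplex K q ha hb hab where
  τ₁ := powImageLE K q hb hb' hbb'
  τ₂ := 𝟙 _
  τ₃ := powImageMap (powQuotient K q hb') q ha (powQuotientMap K q hb hb' hbb')
  comm₁₂ := by
    change powImageLE K q hb hb' hbb' ≫ powImageLE K q ha hb hab =
      powImageLE K q ha hb' (hab.trans hbb') ≫ 𝟙 _
    rw [powImageLE_comp, Category.comp_id]
  comm₂₃ := by
    change 𝟙 _ ≫ powImageToQuotient K q ha hb =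
      powImageToQuotient K q ha hb' ≫
        powImageMap (powQuotient K q hb') q ha (powQuotientMap K q hb hb' hbb')
    rw [Category.id_comp, powImageToQuotient_comp_powImageMap_powQuotientMap]

/-- The components of `staircasePresentationMapOfLE` (definitionally). [folklore] -/
theorem staircasePresentationMapOfLE_τ :
    (staircasePresentationMapOfLE K q ha hb hb' hab hbb').τ₁ = powImageLE K q hb hb' hbb' ∧
      (staircasePresentationMapOfLE K q ha hb hb' hab hbb').τ₂ = 𝟙 _ ∧
        (staircasePresentationMapOfLE K q ha hb hb' hab hbb').τ₃ =
          powImageMap (powQuotient K q hb') q ha (powQuotientMap K q hb hb' hbb') :=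
  ⟨rfl, rfl, rfl⟩

variable {a' : ℕ → ℕ} (ha' : Antitone a') (ha'a : a' ≤ a)

/-- **Naturality of the presentation in `a`**: for `a' ≤ a ≤ b` the morphism of short complexes
from `q^{b}K → q^{a}K → q^{a}(K/q^{b})` to `q^{b}K → q^{a'}K → q^{a'}(K/q^{b})` given by the identity,
the inclusion `q^{a}K ⊆ q^{a'}K` and the inclusion `q^{a}(K/q^{b}) ⊆ q^{a'}(K/q^{b})` (for `K = Ω•`:
over Hu's inclusion `p^{r,M}_{r,N}Ω• ⊆ p^{r,M'}_{r,N}Ω•`, `M' ≤ M`). [folklore] -/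
def staircasePresentationMapOfLE' :
    staircasePresentationShortComplex K q ha hb hab ⟶
      staircasePresentationShortComplex K q ha' hb (ha'a.trans hab) where
  τ₁ := 𝟙 _
  τ₂ := powImageLE K q ha' ha ha'a
  τ₃ := powImageLE (powQuotient K q hb) q ha' ha ha'a
  comm₁₂ := by
    change 𝟙 _ ≫ powImageLE K q ha' hb (ha'a.trans hab) =
      powImageLE K q ha hb hab ≫ powImageLE K q ha' ha ha'a
    rw [Category.id_comp, powImageLE_comp]
  comm₂₃ := by
    change powImageLE K q ha' ha ha'a ≫ powImageToQuotient K q ha' hb =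
      powImageToQuotient K q ha hb ≫ powImageLE (powQuotient K q hb) q ha' ha ha'a
    exact powImageLE_comp_powImageMap_eq K q ha' ha (powQuotientπ K q hb) ha'a

/-- The components of `staircasePresentationMapOfLE'` (definitionally). [folklore] -/
theorem staircasePresentationMapOfLE'_τ :
    (staircasePresentationMapOfLE' K q ha hb hab ha' ha'a).τ₁ = 𝟙 _ ∧
      (staircasePresentationMapOfLE' K q ha hb hab ha' ha'a).τ₂ = powImageLE K q ha' ha ha'a ∧
        (staircasePresentationMapOfLE' K q ha hb hab ha' ha'a).τ₃ =
          powImageLE (powQuotient K q hb) q ha' ha ha'a :=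
  ⟨rfl, rfl, rfl⟩

end Naturality

/-! ### Extension by zero preserves short exact sequences of complexes -/

section Extend

variable {ι ι' : Type*} {c : ComplexShape ι} {c' : ComplexShape ι'} (e : c.Embedding c')

/-- In a degree `e.f i` of the image of the embedding, the degree-`e.f i` part of the extension of
a short complex of complexes is isomorphic to the degree-`i` part of the original. [folklore] -/
def mapExtendFunctorEvalIso (S : ShortComplex (HomologicalComplex 𝒜 c)) {i : ι} {i' : ι'}
    (hi : e.f i = i') :
    (S.map (e.extendFunctor 𝒜)).map (HomologicalComplex.eval 𝒜 c' i') ≅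
      S.map (HomologicalComplex.eval 𝒜 c i) :=
  ShortComplex.isoMk (S.X₁.extendXIso e hi) (S.X₂.extendXIso e hi) (S.X₃.extendXIso e hi)
    (by
      change (S.X₁.extendXIso e hi).hom ≫ S.f.f i =
        (HomologicalComplex.extendMap S.f e).f i' ≫ (S.X₂.extendXIso e hi).hom
      rw [HomologicalComplex.extendMap_f _ e hi, Category.assoc, Category.assoc, Iso.inv_hom_id,
        Category.comp_id])
    (by
      change (S.X₂.extendXIso e hi).hom ≫ S.g.f i =
        (HomologicalComplex.extendMap S.g e).f i' ≫ (S.X₃.extendXIso e hi).hom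
      rw [HomologicalComplex.extendMap_f _ e hi, Category.assoc, Category.assoc, Iso.inv_hom_id,
        Category.comp_id])

/-- **Extension by zero preserves short exactness**: if `S` is a short exact sequence of
`c`-complexes then its extension along an embedding `e : c ↪ c'` of complex shapes (Mathlib's
`ComplexShape.Embedding.extendFunctor`; e.g. `ℕ ↪ ℤ`) is a short exact sequence of `c'`-complexes
(degreewise it is the original sequence in the image of `e.f` and `0 → 0 → 0` elsewhere).
[folklore] -/
theorem shortExact_map_extendFunctor {S : ShortComplex (HomologicalComplex 𝒜 c)}
    (hS : S.ShortExact) : (S.map (e.extendFunctor 𝒜)).ShortExact := by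
  refine HomologicalComplex.shortExact_of_degreewise_shortExact _ fun i' ↦ ?_
  by_cases hi' : ∃ i, e.f i = i'
  · obtain ⟨i, hi⟩ := hi'
    exact ShortComplex.shortExact_of_iso (mapExtendFunctorEvalIso e S hi).symm
      ((HomologicalComplex.shortExact_iff_degreewise_shortExact S).mp hS i)
  · have h₁ : IsZero (((S.map (e.extendFunctor 𝒜)).map (HomologicalComplex.eval 𝒜 c' i')).X₁) :=
      S.X₁.isZero_extend_X e i' fun i hi ↦ hi' ⟨i, hi⟩
    have h₂ : IsZero (((S.map (e.extendFunctor 𝒜)).map (HomologicalComplex.eval 𝒜 c' i')).X₂) :=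
      S.X₂.isZero_extend_X e i' fun i hi ↦ hi' ⟨i, hi⟩
    have h₃ : IsZero (((S.map (e.extendFunctor 𝒜)).map (HomologicalComplex.eval 𝒜 c' i')).X₃) :=
      S.X₃.isZero_extend_X e i' fun i hi ↦ hi' ⟨i, hi⟩
    exact { exact := ShortComplex.exact_of_isZero_X₂ _ h₂
            mono_f := h₁.mono _
            epi_g := h₃.epi _ }

/-- The extension of a short complex of complexes along `e`, spelled with
`HomologicalComplex.extend` / `extendMap` (definitionally `S.map (e.extendFunctor 𝒜)`). [folklore] -/
theorem map_extendFunctor_eq (S : ShortComplex (HomologicalComplex 𝒜 c)) :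
    S.map (e.extendFunctor 𝒜) =
      ShortComplex.mk (HomologicalComplex.extendMap S.f e) (HomologicalComplex.extendMap S.g e)
        (by rw [← HomologicalComplex.extendMap_comp, S.zero, HomologicalComplex.extendMap_zero]) :=
  rfl

end Extend

/-! ### The presentation, extended by zero to `ℤ`-indexed complexes -/

section PresentationInt

variable (K : CochainComplex 𝒜 ℕ) (q : ℤ) {a b : ℕ → ℕ} (ha : Antitone a) (hb : Antitone b)
  (hab : a ≤ b)

/-- The presentation `q^{b}K → q^{a}K → q^{a}(K/q^{b})` extended by zero to `ℤ`-indexed cochain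
complexes (the shape consumed by hyper-Ext / hypercohomology). [folklore] -/
abbrev staircasePresentationShortComplexInt : ShortComplex (CochainComplex 𝒜 ℤ) :=
  (staircasePresentationShortComplex K q ha hb hab).map
    (ComplexShape.embeddingUpNat.extendFunctor 𝒜)

/-- The objects of the `ℤ`-extended presentation are the `ℤ`-extensions of `q^{b}K`, `q^{a}K`,
`q^{a}(K/q^{b})` (definitionally). [folklore] -/
theorem staircasePresentationShortComplexInt_X :
    (staircasePresentationShortComplexInt K q ha hb hab).X₁ =
        (powImage K q hb).extend ComplexShape.embeddingUpNat ∧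
      (staircasePresentationShortComplexInt K q ha hb hab).X₂ =
        (powImage K q ha).extend ComplexShape.embeddingUpNat ∧
      (staircasePresentationShortComplexInt K q ha hb hab).X₃ =
        (powImage (powQuotient K q hb) q ha).extend ComplexShape.embeddingUpNat :=
  ⟨rfl, rfl, rfl⟩

/-- The maps of the `ℤ`-extended presentation are the `extendMap`s of the inclusion and of the
projection (definitionally). [folklore] -/
theorem staircasePresentationShortComplexInt_f_g :
    (staircasePresentationShortComplexInt K q ha hb hab).f =
        HomologicalComplex.extendMap (powImageLE K q ha hb hab) ComplexShape.embeddingUpNat ∧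
      (staircasePresentationShortComplexInt K q ha hb hab).g =
        HomologicalComplex.extendMap (powImageToQuotient K q ha hb) ComplexShape.embeddingUpNat :=
  ⟨rfl, rfl⟩

/-- **The `ℤ`-extended presentation `0 → q^{b}K → q^{a}K → q^{a}(K/q^{b}) → 0` is short exact.**
[folklore] -/
theorem staircasePresentation_shortExact_extend :
    (staircasePresentationShortComplexInt K q ha hb hab).ShortExact :=
  shortExact_map_extendFunctor _ (staircasePresentation_shortExact K q ha hb hab)

end PresentationInt

end Literature.Algebra.Homology

end
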